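import Summits.Parity.GeneralizedHardyLittlewood.Theorems.PrimeLevelFamEdgeMomentsBeyondDiagonalLayersTruncatedBlock
import HarnessLib

/-!
# Route `PrimeLevelFamEdge`, crux K_A `MomentsBeyondDiagonal` (stmt-Parity-20007), line «petersson_layers» v4:
# the BESSEL TRUNCATION ERROR at the level of a layer block

`…LayersBesselSeparation.norm_layerKernel_sub_truncation_le` bounds the layer kernel minus its `K`-term separated truncation
at ONE pair `(a, b)` with `2π²ab ≤ (qr)²`; `…LayersTruncatedBlock` rewrites the truncated block as `K` bilinear-type forms.  Here the
two are joined at the level of a block `Σ_{m₁,n₁,m₂,n₂} W(n₁,n₂)·(X₁(m₁)X₂(m₂)·κ(m₁n₁, m₂n₂))`: if every pair of the block is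
in the alternating regime and `(2π√(ab)/(qr))^{2K+1}/(K!(K+1)!) ≤ ρ` there, then (with the trivial `|S(a,b;qr)| ≤ qr`)

  `‖Block(κ) − Block(κ_K)‖ ≤ 2π·ρ · Σ_{m₁,n₁,m₂,n₂} ‖W(n₁,n₂)‖ ‖X₁(m₁)‖ ‖X₂(m₂)‖`      (`norm_block_sub_truncatedBlock_le`).

In the print / generic bands `ρ` is a large negative power of `q̂` already for `K` of order `10`, so the truncation costs
nothing against the target `q̂ log⁻³ q̂`.  Generic in `W, X₁, X₂` and the index sets.
Proof only (def-free helper toward `stub_farP` / `stub_band`); no layer is bounded here; K_A NOT proved; nothing about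
Landau–Siegel zeros.
-/

noncomputable section

open Finset
open scoped Real Nat
open Literature.NumberTheory.LFunctions

namespace Summit.Parity.GeneralizedHardyLittlewood.Theorems.MomentsBeyondDiagonal.Layers

open Summit.Parity.GeneralizedHardyLittlewood.Theorems.PrimeLevelFamEdgeIdeaDeltas.PeterssonLayers

/-- The block is additive in the kernel (difference form). [folklore] -/
theorem block_sub (S₁ T₁ S₂ T₂ : Finset ℕ) (W : ℕ → ℕ → ℂ) (X₁ X₂ : ℕ → ℂ) (κ₁ κ₂ : ℕ → ℕ → ℂ) :
    ∑ m₁ ∈ S₁, ∑ n₁ ∈ T₁, ∑ m₂ ∈ S₂, ∑ n₂ ∈ T₂, W n₁ n₂ * (X₁ m₁ * X₂ m₂ * κ₁ (m₁ * n₁) (m₂ * n₂)) -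
      ∑ m₁ ∈ S₁, ∑ n₁ ∈ T₁, ∑ m₂ ∈ S₂, ∑ n₂ ∈ T₂, W n₁ n₂ * (X₁ m₁ * X₂ m₂ * κ₂ (m₁ * n₁) (m₂ * n₂)) =
      ∑ m₁ ∈ S₁, ∑ n₁ ∈ T₁, ∑ m₂ ∈ S₂, ∑ n₂ ∈ T₂,
        W n₁ n₂ * (X₁ m₁ * X₂ m₂ * (κ₁ (m₁ * n₁) (m₂ * n₂) - κ₂ (m₁ * n₁) (m₂ * n₂))) := by
  simp only [mul_sub, Finset.sum_sub_distrib]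

/-- **One pair: the kernel minus its truncation, with the trivial Kloosterman bound** (`r ≥ 1`, `2π²ab ≤ (qr)²`):
`‖κ(a,b) − κ_K(a,b)‖ ≤ 2π · (2π√(ab)/(qr))^{2K+1}/(K!(K+1)!)`. [cite: DLMF, 10.2.2; KowalskiMichel2000, §2.4.2 p. 312] -/
theorem norm_layerKernel_sub_truncation_le_trivial (q : ℕ) [NeZero q] {r : ℕ} (hr : 0 < r) (a b K : ℕ)
    (hab : 2 * π ^ 2 * ((a : ℝ) * b) ≤ ((q : ℝ) * r) ^ 2) :
    haveI : NeZero (q * r) := ⟨mul_ne_zero (NeZero.ne q) hr.ne'⟩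
    ‖layerKernel q r a b -
        (2 * (π : ℂ) / (q : ℂ)) * ((r : ℂ)⁻¹ *
          kloostermanSum (q * r) (a : ZMod (q * r)) (b : ZMod (q * r)) *
          ((∑ k ∈ range K, (-1 : ℝ) ^ k / ((k ! : ℝ) * ((k + 1)! : ℝ)) *
            ((2 * π / ((q : ℝ) * r)) ^ (2 * k + 1) * Real.sqrt a ^ (2 * k + 1) * Real.sqrt b ^ (2 * k + 1)) : ℝ) : ℂ))‖ ≤
      2 * π * ((2 * π * Real.sqrt ((a : ℝ) * b) / ((q : ℝ) * r)) ^ (2 * K + 1) / ((K ! : ℝ) * ((K + 1)! : ℝ))) := by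
  haveI : NeZero (q * r) := ⟨mul_ne_zero (NeZero.ne q) hr.ne'⟩
  have h := norm_layerKernel_sub_truncation_le q hr a b K hab
  refine h.trans ?_
  have hq0 : (0 : ℝ) < q := by exact_mod_cast Nat.pos_of_ne_zero (NeZero.ne q)
  have hr0 : (0 : ℝ) < r := by exact_mod_cast hr
  have hS : ‖kloostermanSum (q * r) (a : ZMod (q * r)) (b : ZMod (q * r))‖ ≤ (q : ℝ) * r := by
    have := norm_kloostermanSum_le (q := q * r) (a : ZMod (q * r)) (b : ZMod (q * r))
    exact_mod_cast this
  have hrem0 : 0 ≤ (2 * π * Real.sqrt ((a : ℝ) * b) / ((q : ℝ) * r)) ^ (2 * K + 1) / ((K ! : ℝ) * ((K + 1)! : ℝ)) := by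
    positivity
  calc (2 * π / (q : ℝ)) * ((r : ℝ)⁻¹ * ‖kloostermanSum (q * r) (a : ZMod (q * r)) (b : ZMod (q * r))‖ *
        ((2 * π * Real.sqrt ((a : ℝ) * b) / ((q : ℝ) * r)) ^ (2 * K + 1) / ((K ! : ℝ) * ((K + 1)! : ℝ))))
      ≤ (2 * π / (q : ℝ)) * ((r : ℝ)⁻¹ * ((q : ℝ) * r) *
        ((2 * π * Real.sqrt ((a : ℝ) * b) / ((q : ℝ) * r)) ^ (2 * K + 1) / ((K ! : ℝ) * ((K + 1)! : ℝ)))) := by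
        gcongr
    _ = 2 * π * ((2 * π * Real.sqrt ((a : ℝ) * b) / ((q : ℝ) * r)) ^ (2 * K + 1) / ((K ! : ℝ) * ((K + 1)! : ℝ))) := by
        field_simp

/-- **The truncation error of a block**: if on the block every pair `(a, b) = (m₁n₁, m₂n₂)` satisfies `2π²ab ≤ (qr)²` and
`(2π√(ab)/(qr))^{2K+1}/(K!(K+1)!) ≤ ρ`, then
`‖Block(κ) − Block(κ_K)‖ ≤ 2π ρ · Σ ‖W(n₁,n₂)‖ ‖X₁(m₁)‖ ‖X₂(m₂)‖`. [cite: DLMF, 10.2.2; KowalskiMichel2000, §2.4.2 p. 312] -/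
theorem norm_block_sub_truncatedBlock_le (q : ℕ) [NeZero q] {r : ℕ} (hr : 0 < r) (S₁ T₁ S₂ T₂ : Finset ℕ)
    (W : ℕ → ℕ → ℂ) (X₁ X₂ : ℕ → ℂ) (K : ℕ) {ρ : ℝ}
    (hbox : ∀ m₁ ∈ S₁, ∀ n₁ ∈ T₁, ∀ m₂ ∈ S₂, ∀ n₂ ∈ T₂,
      2 * π ^ 2 * (((m₁ * n₁ : ℕ) : ℝ) * ((m₂ * n₂ : ℕ) : ℝ)) ≤ ((q : ℝ) * r) ^ 2 ∧
      (2 * π * Real.sqrt (((m₁ * n₁ : ℕ) : ℝ) * ((m₂ * n₂ : ℕ) : ℝ)) / ((q : ℝ) * r)) ^ (2 * K + 1) /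
        ((K ! : ℝ) * ((K + 1)! : ℝ)) ≤ ρ) :
    haveI : NeZero (q * r) := ⟨mul_ne_zero (NeZero.ne q) hr.ne'⟩
    ‖∑ m₁ ∈ S₁, ∑ n₁ ∈ T₁, ∑ m₂ ∈ S₂, ∑ n₂ ∈ T₂,
        W n₁ n₂ * (X₁ m₁ * X₂ m₂ * layerKernel q r (m₁ * n₁) (m₂ * n₂)) -
      ∑ m₁ ∈ S₁, ∑ n₁ ∈ T₁, ∑ m₂ ∈ S₂, ∑ n₂ ∈ T₂,
        W n₁ n₂ * (X₁ m₁ * X₂ m₂ *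
          ((2 * (π : ℂ) / (q : ℂ)) * ((r : ℂ)⁻¹ *
            kloostermanSum (q * r) ((m₁ * n₁ : ℕ) : ZMod (q * r)) ((m₂ * n₂ : ℕ) : ZMod (q * r)) *
            ((∑ k ∈ range K, (-1 : ℝ) ^ k / ((k ! : ℝ) * ((k + 1)! : ℝ)) *
              ((2 * π / ((q : ℝ) * r)) ^ (2 * k + 1) * Real.sqrt ((m₁ * n₁ : ℕ) : ℝ) ^ (2 * k + 1) *
                Real.sqrt ((m₂ * n₂ : ℕ) : ℝ) ^ (2 * k + 1)) : ℝ) : ℂ))))‖ ≤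
      2 * π * ρ * ∑ m₁ ∈ S₁, ∑ n₁ ∈ T₁, ∑ m₂ ∈ S₂, ∑ n₂ ∈ T₂, ‖W n₁ n₂‖ * (‖X₁ m₁‖ * ‖X₂ m₂‖) := by
  haveI : NeZero (q * r) := ⟨mul_ne_zero (NeZero.ne q) hr.ne'⟩
  simp only [← Finset.sum_sub_distrib, ← mul_sub]
  rw [Finset.mul_sum]
  refine (norm_sum_le _ _).trans (Finset.sum_le_sum fun m₁ hm₁ ↦ ?_)
  rw [Finset.mul_sum]
  refine (norm_sum_le _ _).trans (Finset.sum_le_sum fun n₁ hn₁ ↦ ?_)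
  rw [Finset.mul_sum]
  refine (norm_sum_le _ _).trans (Finset.sum_le_sum fun m₂ hm₂ ↦ ?_)
  rw [Finset.mul_sum]
  refine (norm_sum_le _ _).trans (Finset.sum_le_sum fun n₂ hn₂ ↦ ?_)
  obtain ⟨hab, hrem⟩ := hbox m₁ hm₁ n₁ hn₁ m₂ hm₂ n₂ hn₂
  have hk := norm_layerKernel_sub_truncation_le_trivial q hr (m₁ * n₁) (m₂ * n₂) K hab
  rw [norm_mul, norm_mul, norm_mul]
  have hρ0 : 0 ≤ ρ := le_trans (by positivity) hrem
  calc ‖W n₁ n₂‖ * (‖X₁ m₁‖ * ‖X₂ m₂‖ * ‖layerKernel q r (m₁ * n₁) (m₂ * n₂) -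
          (2 * (π : ℂ) / (q : ℂ)) * ((r : ℂ)⁻¹ *
            kloostermanSum (q * r) ((m₁ * n₁ : ℕ) : ZMod (q * r)) ((m₂ * n₂ : ℕ) : ZMod (q * r)) *
            ((∑ k ∈ range K, (-1 : ℝ) ^ k / ((k ! : ℝ) * ((k + 1)! : ℝ)) *
              ((2 * π / ((q : ℝ) * r)) ^ (2 * k + 1) * Real.sqrt ((m₁ * n₁ : ℕ) : ℝ) ^ (2 * k + 1) *
                Real.sqrt ((m₂ * n₂ : ℕ) : ℝ) ^ (2 * k + 1)) : ℝ) : ℂ))‖)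
      ≤ ‖W n₁ n₂‖ * (‖X₁ m₁‖ * ‖X₂ m₂‖ * (2 * π * ρ)) := by
        refine mul_le_mul_of_nonneg_left (mul_le_mul_of_nonneg_left (hk.trans ?_) (by positivity)) (norm_nonneg _)
        exact mul_le_mul_of_nonneg_left hrem (by positivity)
    _ = 2 * π * ρ * (‖W n₁ n₂‖ * (‖X₁ m₁‖ * ‖X₂ m₂‖)) := by ring

/-! ## Appendix (same seat, same day): discharging the box hypothesis from two global size constraints

In the assembly the pairs of a block satisfy `m₁m₂ ≤ U` and `n₁n₂ ≤ V` (main n-range); then the hypothesis `hbox` of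
`norm_block_sub_truncatedBlock_le` follows from the two numbers `2π²UV ≤ (qr)²` and
`ρ := (2π√(UV)/(qr))^{2K+1}/(K!(K+1)!)` (monotonicity in `ab ≤ UV`). -/

/-- **The box hypothesis from global bounds**: if `m₁m₂ ≤ U`, `n₁n₂ ≤ V` and `2π²UV ≤ (qr)²` (`q, r ≥ 1`), then the pair
`(a, b) = (m₁n₁, m₂n₂)` is in the alternating regime and its Bessel remainder is at most `(2π√(UV)/(qr))^{2K+1}/(K!(K+1)!)`.
[cite: DLMF, 10.2.2] -/
theorem box_hypothesis_of_le {q r : ℕ} (hq : 0 < q) (hr : 0 < r) {U V : ℝ} {m₁ n₁ m₂ n₂ : ℕ}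
    (hm : ((m₁ * m₂ : ℕ) : ℝ) ≤ U) (hn : ((n₁ * n₂ : ℕ) : ℝ) ≤ V) (hUV : 2 * π ^ 2 * (U * V) ≤ ((q : ℝ) * r) ^ 2) (K : ℕ) :
    2 * π ^ 2 * (((m₁ * n₁ : ℕ) : ℝ) * ((m₂ * n₂ : ℕ) : ℝ)) ≤ ((q : ℝ) * r) ^ 2 ∧
      (2 * π * Real.sqrt (((m₁ * n₁ : ℕ) : ℝ) * ((m₂ * n₂ : ℕ) : ℝ)) / ((q : ℝ) * r)) ^ (2 * K + 1) /
          ((K ! : ℝ) * ((K + 1)! : ℝ)) ≤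
        (2 * π * Real.sqrt (U * V) / ((q : ℝ) * r)) ^ (2 * K + 1) / ((K ! : ℝ) * ((K + 1)! : ℝ)) := by
  have hab : ((m₁ * n₁ : ℕ) : ℝ) * ((m₂ * n₂ : ℕ) : ℝ) = ((m₁ * m₂ : ℕ) : ℝ) * ((n₁ * n₂ : ℕ) : ℝ) := by
    push_cast; ring
  have hU0 : 0 ≤ U := le_trans (Nat.cast_nonneg _) hm
  have hV0 : 0 ≤ V := le_trans (Nat.cast_nonneg _) hn
  have hle : ((m₁ * n₁ : ℕ) : ℝ) * ((m₂ * n₂ : ℕ) : ℝ) ≤ U * V := by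
    rw [hab]; exact mul_le_mul hm hn (Nat.cast_nonneg _) hU0
  have hqr : (0 : ℝ) < (q : ℝ) * r := by positivity
  refine ⟨?_, ?_⟩
  · calc 2 * π ^ 2 * (((m₁ * n₁ : ℕ) : ℝ) * ((m₂ * n₂ : ℕ) : ℝ)) ≤ 2 * π ^ 2 * (U * V) := by
          gcongr
      _ ≤ ((q : ℝ) * r) ^ 2 := hUV
  · have hsq : Real.sqrt (((m₁ * n₁ : ℕ) : ℝ) * ((m₂ * n₂ : ℕ) : ℝ)) ≤ Real.sqrt (U * V) := Real.sqrt_le_sqrt hle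
    have h0 : 0 ≤ 2 * π * Real.sqrt (((m₁ * n₁ : ℕ) : ℝ) * ((m₂ * n₂ : ℕ) : ℝ)) / ((q : ℝ) * r) := by positivity
    gcongr

end Summit.Parity.GeneralizedHardyLittlewood.Theorems.MomentsBeyondDiagonal.Layers

end
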